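import Summits.CriticalPhenomena.Ising3DConformalLimit.Theses.LeeYangGap
import Summits.CriticalPhenomena.Ising3DConformalLimit.Theses.LatticeSDPCertificates
import Summits.CriticalPhenomena.Ising3DConformalLimit.Theorems.PerfectScreeningCoulombImpliesNontrivialGapOfBinder
import Summits.CriticalPhenomena.Ising3DConformalLimit.Theorems.PerfectScreeningCoulombImpliesNontrivialOfLeeYangGap
import Summits.CriticalPhenomena.Ising3DConformalLimit.Theorems.ArmHyperscalingMergingFloorGlue
import HarnessLib

/-!
# Strategy census `s3` (independent family `s`) — crux `LeeYangGap.NearCriticalLeeYangGap`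
# (stmt-CriticalPhenomena-4945): the typed attempts

Companion of `STRATEGY-CENSUS-s3.md` (planner-cstrat-stmt-CriticalPhenomena-4945-s3-0, 2026-08-17).
Nothing in this file is `sorry`d: open statements are `def … : Prop`, everything named `theorem` is
kernel-checked from LANDED tree theorems.

* §0 `nearCriticalLeeYangGap_iff_not_tendsto_binder` — GAP ⟺ the critical block Binder cumulant
  `g_L = (3Σ_L² − ⟨M_L⁴⟩)/Σ_L²` does not tend to `0` (assembled from
  `sketchPub_binderNonvanishing_of_nearCriticalLeeYangGap` and `stub_gapOfBinderNonvanishing`).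
  This is the form in which every strategy below meets the crux.
* §1 WEAKER INTERMEDIATE (inventory 1). `BinderFloorFrequently` (∃ c > 0, g_L ≥ c frequently) is
  literally equivalent to GAP (`binderFloorFrequently_iff`); the only strictly weaker statements the
  route's `closes` could consume instead are limit-level (`HasNontrivialU4` of a limit family) and are
  other routes' cruxes — recorded in the markdown, not re-typed here.
* §2 DECOMPOSITION (inventory 2): Newman 1979, Cor. 2.6, typed LIMIT-FREE with `κ = 1/δ`:
  `DeltaIsothermUpper κ` (upper critical isotherm `M(β_c,h) ≤ A h^κ`, the δ-hyperscaling half) and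
  `LogFreeBlockVariance κ` (`Σ_L ≥ ε L^{6/(1+κ)}` frequently — the log-free block second moment at the
  hyperscaling-matched exponent `6/(1+κ) = d + 2 − η`) give GAP:
  `nearCriticalLeeYangGap_of_newman`. The assembly is PROVED here (through the landed Lee–Yang
  deficit `stub_leeYangDeficit`, GKS block-field domination `stub_blockFieldDomination`,
  `binder_lower_of_saturation` and `stub_gapOfBinderNonvanishing`); the two pieces are the open,
  engine-less inputs (markdown §2 says why this is relocation, not leverage).
* §3 STRENGTHEN (inventory "strengthen"): `BinderFloorEventually` (S⁺: the floor for ALL large L)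
  and `TopHeavyBubbleFrequently`; `binderFloorEventually_imp` records S⁺ ⟹ GAP.
-/

noncomputable section

namespace Summit.CriticalPhenomena.Ising3DConformalLimit.Cruxes.NearCriticalLeeYangGap.CensusS3

open Literature.Probability.LatticeModels Filter Set Finset
open scoped Topology BigOperators

/-! ## §0 The crux in Binder form -/

/-- The critical block Binder ratio `g_L = (3Σ_L² − ⟨M_L⁴⟩)/Σ_L²` of `M_L = Σ_{x ∈ box 3 L} σ_x` in the
plus state at `β_c(3)`, `h = 0` (`= −u₄(M_L)/Σ_L²`, nonnegative by Lebowitz/Newman). -/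
def binder (L : ℕ) : ℝ :=
  (3 * (plusExpect 3 (criticalBeta 3) 0 (fun σ => (∑ x ∈ box 3 L, spinAt x σ) ^ 2)) ^ 2 -
      plusExpect 3 (criticalBeta 3) 0 (fun σ => (∑ x ∈ box 3 L, spinAt x σ) ^ 4)) /
    (plusExpect 3 (criticalBeta 3) 0 (fun σ => (∑ x ∈ box 3 L, spinAt x σ) ^ 2)) ^ 2

/-- **GAP ⟺ ¬(g_L → 0)** — both directions are landed tree theorems (PerfectScreening line `SketchPub`
v11 + the LeeYangGap supports `FirstZeroAntitoneInBeta`, `MonotonicityTransfer`). -/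
theorem nearCriticalLeeYangGap_iff_not_tendsto_binder :
    Theses.LeeYangGap.NearCriticalLeeYangGap ↔ ¬ Tendsto binder atTop (𝓝 0) :=
  ⟨fun h => PerfectScreeningCoulombImpliesNontrivial.sketchPub_binderNonvanishing_of_nearCriticalLeeYangGap h,
    fun h => PerfectScreeningCoulombImpliesNontrivial.stub_gapOfBinderNonvanishing h⟩

/-! ## §1 Weaker intermediate: the frequent Binder floor is NOT weaker -/

/-- `∃ c > 0`, `g_L ≥ c` along a subsequence. -/
def BinderFloorFrequently : Prop := ∃ c : ℝ, 0 < c ∧ ∃ᶠ L : ℕ in atTop, c ≤ binder L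

theorem binder_nonneg (L : ℕ) : 0 ≤ binder L := by
  unfold binder
  obtain ⟨m, n, b, hb, -, -, -, hineq⟩ := PerfectScreeningCoulombImpliesNontrivial.blockPackage_reverse L
  have h1 : 0 ≤ 2 * (m : ℝ) + 12 * ∑ i, b i ^ 2 - 8 * ∑ i, b i := by
    have : 8 * ∑ i, b i ≤ 12 * ∑ i, b i ^ 2 := by
      rw [Finset.mul_sum, Finset.mul_sum]
      exact Finset.sum_le_sum fun i _ => by nlinarith [hb i]
    have hm : 0 ≤ (m : ℝ) := Nat.cast_nonneg m
    linarith
  exact div_nonneg (h1.trans hineq) (sq_nonneg _)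

theorem not_tendsto_of_floorFrequently (h : BinderFloorFrequently) : ¬ Tendsto binder atTop (𝓝 0) := by
  rintro ht
  obtain ⟨c, hc, hfr⟩ := h
  obtain ⟨L, h1, h2⟩ := (hfr.and_eventually (ht.eventually (gt_mem_nhds hc))).exists
  exact absurd h1 (not_le.2 h2)

theorem floorFrequently_of_not_tendsto (h : ¬ Tendsto binder atTop (𝓝 0)) : BinderFloorFrequently := by
  by_contra hno
  apply h
  rw [Metric.tendsto_atTop]
  intro ε hε
  by_contra hN
  push_neg at hN
  apply hno
  refine ⟨ε, hε, Filter.frequently_atTop.2 fun N => ?_⟩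
  obtain ⟨L, hL, hd⟩ := hN N
  refine ⟨L, hL, ?_⟩
  have h0 := binder_nonneg L
  rw [Real.dist_eq, sub_zero, abs_of_nonneg h0] at hd
  exact hd

/-- The frequent Binder floor is the crux itself, not a weaker intermediate. -/
theorem binderFloorFrequently_iff :
    BinderFloorFrequently ↔ Theses.LeeYangGap.NearCriticalLeeYangGap := by
  rw [nearCriticalLeeYangGap_iff_not_tendsto_binder]
  exact ⟨not_tendsto_of_floorFrequently, floorFrequently_of_not_tendsto⟩

/-! ## §2 Decomposition: Newman's criterion, typed limit-free -/

/-- **D1(κ) — upper critical isotherm with exponent `κ = 1/δ`:** `M(β_c, h) ≤ A h^κ` for small `h > 0`.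
δ-hyperscaling in `d = 3` is `κ = (1+η)/(5−η)`; Newman 1979 (2.25). In the tree only `κ = 1/3` is a
theorem (mean-field bound, ABF87); any `κ > 1/3` is open. -/
def DeltaIsothermUpper (κ : ℝ) : Prop :=
  ∃ A h₀ : ℝ, 0 < h₀ ∧ ∀ h : ℝ, 0 < h → h ≤ h₀ →
    magnetizationInField 3 (criticalBeta 3) h ≤ A * h ^ κ

/-- **D2(κ) — log-free block second moment at the matched exponent:** along a subsequence,
`Σ_L = ⟨M_L²⟩_{β_c} ≥ ε L^{6/(1+κ)}` (`6/(1+κ) = 6δ/(1+δ) = d + 2 − η` under hyperscaling; Newman 1979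
(2.26) `G(R) ≥ ε R^{2−η}`). -/
def LogFreeBlockVariance (κ : ℝ) : Prop :=
  ∃ ε : ℝ, 0 < ε ∧ ∃ᶠ L : ℕ in atTop,
    ε * (L : ℝ) ^ (6 / (1 + κ)) ≤ plusExpect 3 (criticalBeta 3) 0 (fun σ => (∑ x ∈ box 3 L, spinAt x σ) ^ 2)

/-- The matched upper isotherm along a subsequence (the `∃ᶠ` form of 0636's `MatchedUpperIsotherm`). -/
def MatchedUpperIsothermFrequently : Prop :=
  ∃ C : ℝ, 0 < C ∧ ∃ᶠ L : ℕ in atTop,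
    (2 * (L : ℝ) + 1) ^ 3 * magnetizationInField 3 (criticalBeta 3)
        (C / Real.sqrt (plusExpect 3 (criticalBeta 3) 0 (fun σ => (∑ x ∈ box 3 L, spinAt x σ) ^ 2))) ≤
      criticalBeta 3 * C / 2 *
        Real.sqrt (plusExpect 3 (criticalBeta 3) 0 (fun σ => (∑ x ∈ box 3 L, spinAt x σ) ^ 2))

/-- Pointwise version of the landed `eventually_binder_ge_of_matchedIsotherm`: at a scale `L` where the
isotherm is matched with constant `C`, `g_L ≥ 1/(2β_c²C²)`. -/
theorem binder_ge_of_matched_at {C : ℝ} (hC : 0 < C) (L : ℕ)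
    (hL : (2 * (L : ℝ) + 1) ^ 3 * magnetizationInField 3 (criticalBeta 3)
        (C / Real.sqrt (plusExpect 3 (criticalBeta 3) 0 (fun σ => (∑ x ∈ box 3 L, spinAt x σ) ^ 2))) ≤
      criticalBeta 3 * C / 2 *
        Real.sqrt (plusExpect 3 (criticalBeta 3) 0 (fun σ => (∑ x ∈ box 3 L, spinAt x σ) ^ 2))) :
    1 / (2 * criticalBeta 3 ^ 2 * C ^ 2) ≤ binder L := by
  have hβ : 0 < criticalBeta 3 := criticalBeta_pos_holds (d := 3) (by norm_num)
  unfold binder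
  set Sg : ℝ := plusExpect 3 (criticalBeta 3) 0 (fun σ => (∑ x ∈ box 3 L, spinAt x σ) ^ 2) with hSgdef
  have hSg : 0 < Sg := PerfectScreeningCoulombImpliesNontrivial.sketchPub_blockVariance_pos L
  set h : ℝ := C / Real.sqrt Sg with hh
  have hh0 : 0 ≤ h := by positivity
  have hdom := PerfectScreeningCoulombImpliesNontrivial.stub_blockFieldDomination L h hh0
  obtain ⟨hZ, hdefL⟩ := ArmHyperscalingMergingFloor.stub_leeYangDeficit L (criticalBeta 3 * h) (by positivity)
  have key := ArmHyperscalingMergingFloor.binder_lower_of_saturation (β := criticalBeta 3) (C := C) (Sg := Sg)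
    (K := 3 * Sg ^ 2 - plusExpect 3 (criticalBeta 3) 0 (fun σ => (∑ x ∈ box 3 L, spinAt x σ) ^ 4))
    hβ hC hSg hZ (by simpa [hh, mul_assoc] using hdefL) hdom (by simpa [hh] using hL)
  simpa using key

theorem binderFloorFrequently_of_matched (h : MatchedUpperIsothermFrequently) : BinderFloorFrequently := by
  obtain ⟨C, hC, hfr⟩ := h
  have hβ : 0 < criticalBeta 3 := criticalBeta_pos_holds (d := 3) (by norm_num)
  exact ⟨1 / (2 * criticalBeta 3 ^ 2 * C ^ 2), by positivity, hfr.mono fun L hL => binder_ge_of_matched_at hC L hL⟩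

/-- `(2L+1)³ ≤ 27 L³` for `L ≥ 1`. -/
theorem cube_le {L : ℕ} (hL : 1 ≤ L) : (2 * (L : ℝ) + 1) ^ 3 ≤ 27 * (L : ℝ) ^ 3 := by
  have hL' : (1 : ℝ) ≤ L := by exact_mod_cast hL
  have h3 : 2 * (L : ℝ) + 1 ≤ 3 * L := by linarith
  calc (2 * (L : ℝ) + 1) ^ 3 ≤ (3 * (L : ℝ)) ^ 3 := by gcongr
    _ = 27 * (L : ℝ) ^ 3 := by ring

/-- Choice of the matching constant: for `Q > 0` and `κ < 1` there is `C ≥ 1` with `Q ≤ C^{1−κ}`. -/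
theorem exists_const_rpow_ge {Q κ : ℝ} (hQ : 0 < Q) (hκ : κ < 1) :
    ∃ C : ℝ, 1 ≤ C ∧ Q ≤ C ^ (1 - κ) := by
  refine ⟨max 1 (Q ^ (1 / (1 - κ))), le_max_left _ _, ?_⟩
  have h1κ : 0 < 1 - κ := by linarith
  have hC0 : 0 ≤ Q ^ (1 / (1 - κ)) := Real.rpow_nonneg hQ.le _
  calc Q = (Q ^ (1 / (1 - κ))) ^ (1 - κ) := by
        rw [← Real.rpow_mul hQ.le, one_div, inv_mul_cancel₀ h1κ.ne', Real.rpow_one]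
    _ ≤ (max 1 (Q ^ (1 / (1 - κ)))) ^ (1 - κ) :=
        Real.rpow_le_rpow hC0 (le_max_right _ _) h1κ.le

/-- **Newman's criterion, matched form.** `D1(κ) ∧ D2(κ)` with `0 < κ < 1` give the matched upper isotherm
along the subsequence of `D2`. Pure arithmetic: with `h_L = C/√Σ_L`, `(2L+1)³ M(h_L) ≤ 27 L³ A h_L^κ
≤ 27 A C^κ L³ (εL^{6/(1+κ)})^{-κ/2}` while `(β_c C/2)√Σ_L ≥ (β_c C/2)(εL^{6/(1+κ)})^{1/2}`, and the powers of
`L` cancel exactly (`(6/(1+κ))·(1+κ)/2 = 3`); `C` large closes it since `κ < 1`. -/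
theorem matched_of_newman {κ : ℝ} (hκ0 : 0 < κ) (hκ1 : κ < 1)
    (h1 : DeltaIsothermUpper κ) (h2 : LogFreeBlockVariance κ) : MatchedUpperIsothermFrequently := by
  obtain ⟨A, h₀, hh₀, hiso⟩ := h1
  obtain ⟨ε, hε, hfr⟩ := h2
  have hβ : 0 < criticalBeta 3 := criticalBeta_pos_holds (d := 3) (by norm_num)
  -- exponents
  set p : ℝ := (1 + κ) / 2 with hp
  set b : ℝ := 6 / (1 + κ) with hb
  have h1κ : 0 < 1 + κ := by linarith
  have hp0 : 0 < p := by positivity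
  have hb0 : 0 < b := by positivity
  have hbp : b * p = 3 := by
    rw [hb, hp]; field_simp; norm_num
  -- constants
  set A' : ℝ := max A 1 with hA'
  have hA'1 : 1 ≤ A' := le_max_right _ _
  have hA'0 : 0 < A' := by linarith
  have hAA' : A ≤ A' := le_max_left _ _
  have hεp : 0 < ε ^ p := Real.rpow_pos_of_pos hε p
  set Q : ℝ := 54 * A' / (criticalBeta 3 * ε ^ p) with hQ
  have hQ0 : 0 < Q := by positivity
  obtain ⟨C, hC1, hCQ⟩ := exists_const_rpow_ge hQ0 hκ1
  have hC0 : 0 < C := by linarith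
  -- the key constant inequality `54 A' C^κ ≤ β_c ε^p C`
  have hconst : 54 * A' * C ^ κ ≤ criticalBeta 3 * ε ^ p * C := by
    have hCk : 0 < C ^ κ := Real.rpow_pos_of_pos hC0 κ
    have : 54 * A' ≤ criticalBeta 3 * ε ^ p * C ^ (1 - κ) := by
      have := mul_le_mul_of_nonneg_left hCQ (by positivity : (0 : ℝ) ≤ criticalBeta 3 * ε ^ p)
      rwa [hQ, mul_div_cancel₀ _ (by positivity : criticalBeta 3 * ε ^ p ≠ 0)] at this
    calc 54 * A' * C ^ κ ≤ criticalBeta 3 * ε ^ p * C ^ (1 - κ) * C ^ κ :=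
          mul_le_mul_of_nonneg_right this hCk.le
      _ = criticalBeta 3 * ε ^ p * C := by
          rw [mul_assoc, ← Real.rpow_add hC0, sub_add_cancel, Real.rpow_one]
  refine ⟨C, hC0, ?_⟩
  -- the good scales: D2's subsequence, intersected with `L ≥ 1` and `(C/h₀)²/ε ≤ L^b`
  have hevB : ∀ᶠ L : ℕ in atTop, (C / h₀) ^ 2 / ε ≤ (L : ℝ) ^ b :=
    ((tendsto_rpow_atTop hb0).comp tendsto_natCast_atTop_atTop).eventually_ge_atTop _
  have hev1 : ∀ᶠ L : ℕ in atTop, 1 ≤ L := eventually_ge_atTop 1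
  refine (hfr.and_eventually (hevB.and hev1)).mono ?_
  rintro L ⟨hvar, hB, hL1⟩
  -- notation
  set S : ℝ := plusExpect 3 (criticalBeta 3) 0 (fun σ => (∑ x ∈ box 3 L, spinAt x σ) ^ 2) with hS
  have hSpos : 0 < S := PerfectScreeningCoulombImpliesNontrivial.sketchPub_blockVariance_pos L
  have hL0 : (0 : ℝ) ≤ L := Nat.cast_nonneg L
  have hLb0 : 0 ≤ (L : ℝ) ^ b := Real.rpow_nonneg hL0 b
  set u : ℝ := Real.sqrt (ε * (L : ℝ) ^ b) with hu
  have hεLb : 0 < ε * (L : ℝ) ^ b := by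
    have : 0 < (L : ℝ) ^ b := Real.rpow_pos_of_pos (by exact_mod_cast hL1) b
    positivity
  have hu0 : 0 < u := Real.sqrt_pos.2 hεLb
  have hus : u ≤ Real.sqrt S := Real.sqrt_le_sqrt hvar
  have hs0 : 0 < Real.sqrt S := Real.sqrt_pos.2 hSpos
  -- (i) the field `h_L = C/√S` is admissible: `0 < h_L ≤ h₀`
  have hhL0 : 0 < C / Real.sqrt S := by positivity
  have huge : C / h₀ ≤ u := by
    have h1 : (C / h₀) ^ 2 ≤ ε * (L : ℝ) ^ b := by
      rwa [div_le_iff₀ hε, mul_comm] at hB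
    calc C / h₀ = Real.sqrt ((C / h₀) ^ 2) := by rw [Real.sqrt_sq (by positivity)]
      _ ≤ u := Real.sqrt_le_sqrt h1
  have hhLh₀ : C / Real.sqrt S ≤ h₀ := by
    calc C / Real.sqrt S ≤ C / u := by gcongr
      _ ≤ C / (C / h₀) := by gcongr
      _ = h₀ := by field_simp
  -- (ii) isotherm: `M(h_L) ≤ A' (C/u)^κ`
  have hM : magnetizationInField 3 (criticalBeta 3) (C / Real.sqrt S) ≤ A' * (C / u) ^ κ := by
    have hk0 : 0 ≤ (C / Real.sqrt S) ^ κ := Real.rpow_nonneg hhL0.le κ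
    calc magnetizationInField 3 (criticalBeta 3) (C / Real.sqrt S) ≤ A * (C / Real.sqrt S) ^ κ :=
          hiso _ hhL0 hhLh₀
      _ ≤ A' * (C / Real.sqrt S) ^ κ := mul_le_mul_of_nonneg_right hAA' hk0
      _ ≤ A' * (C / u) ^ κ := by
          refine mul_le_mul_of_nonneg_left (Real.rpow_le_rpow hhL0.le ?_ hκ0.le) hA'0.le
          gcongr
  -- (iii) `u^{1+κ} = ε^p L³`
  have hupow : u ^ (1 + κ) = ε ^ p * (L : ℝ) ^ 3 := by
    have h2p : (1 + κ) = 2 * p := by rw [hp]; ring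
    rw [h2p, Real.rpow_mul hu0.le, Real.rpow_two, hu, Real.sq_sqrt hεLb.le, Real.mul_rpow hε.le hLb0,
      ← Real.rpow_mul hL0, hbp, show (3 : ℝ) = ((3 : ℕ) : ℝ) by norm_num, Real.rpow_natCast]
  -- (iv) assemble
  have hCuk : (C / u) ^ κ = C ^ κ / u ^ κ := Real.div_rpow hC0.le hu0.le κ
  have huk0 : 0 < u ^ κ := Real.rpow_pos_of_pos hu0 κ
  have hmain : 27 * (L : ℝ) ^ 3 * (A' * (C / u) ^ κ) ≤ criticalBeta 3 * C / 2 * u := by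
    rw [hCuk]
    rw [show 27 * (L : ℝ) ^ 3 * (A' * (C ^ κ / u ^ κ)) = (27 * (L : ℝ) ^ 3 * A' * C ^ κ) / u ^ κ by ring]
    rw [div_le_iff₀ huk0]
    have hu1k : criticalBeta 3 * C / 2 * u * u ^ κ = criticalBeta 3 * C / 2 * u ^ (1 + κ) := by
      rw [Real.rpow_add hu0, Real.rpow_one]; ring
    rw [hu1k, hupow]
    have hL3 : 0 ≤ (L : ℝ) ^ 3 := by positivity
    nlinarith [mul_le_mul_of_nonneg_right hconst hL3]
  calc (2 * (L : ℝ) + 1) ^ 3 * magnetizationInField 3 (criticalBeta 3) (C / Real.sqrt S)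
      ≤ 27 * (L : ℝ) ^ 3 * (A' * (C / u) ^ κ) := by
        have hm0 : 0 ≤ magnetizationInField 3 (criticalBeta 3) (C / Real.sqrt S) := by
          rw [magnetizationInField_eq_plusCorr]; exact plusCorr_nonneg hβ.le hhL0.le {0}
        exact mul_le_mul (cube_le hL1) hM hm0 (by positivity)
    _ ≤ criticalBeta 3 * C / 2 * u := hmain
    _ ≤ criticalBeta 3 * C / 2 * Real.sqrt S := by gcongr

/-- **The decomposition, assembled (kernel-checked):** Newman's two 1979 hypotheses, typed limit-free,
give the crux. `Sub₁ = DeltaIsothermUpper κ`, `Sub₂ = LogFreeBlockVariance κ` (same `κ ∈ (0,1)`). -/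
theorem nearCriticalLeeYangGap_of_newman {κ : ℝ} (hκ0 : 0 < κ) (hκ1 : κ < 1)
    (h1 : DeltaIsothermUpper κ) (h2 : LogFreeBlockVariance κ) :
    Theses.LeeYangGap.NearCriticalLeeYangGap :=
  binderFloorFrequently_iff.1 (binderFloorFrequently_of_matched (matched_of_newman hκ0 hκ1 h1 h2))

/-- Curried `∃κ` form, the shape a `route edit --split` glue would take. -/
def NewmanPair : Prop := ∃ κ : ℝ, 0 < κ ∧ κ < 1 ∧ DeltaIsothermUpper κ ∧ LogFreeBlockVariance κ

theorem nearCriticalLeeYangGap_of_newmanPair (h : NewmanPair) : Theses.LeeYangGap.NearCriticalLeeYangGap := by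
  obtain ⟨κ, hκ0, hκ1, h1, h2⟩ := h
  exact nearCriticalLeeYangGap_of_newman hκ0 hκ1 h1 h2

/-! ## §3 Strengthenings (typed; S⁺ ⟹ GAP recorded) -/

/-- **S⁺₁ — eventual Binder floor** (`liminf g_L > 0`, what the numerics show: `g_L → g* ≈ 0.85`). -/
def BinderFloorEventually : Prop := ∃ c : ℝ, 0 < c ∧ ∀ᶠ L : ℕ in atTop, c ≤ binder L

theorem binderFloorEventually_imp (h : BinderFloorEventually) : Theses.LeeYangGap.NearCriticalLeeYangGap := by
  obtain ⟨c, hc, hev⟩ := h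
  exact binderFloorFrequently_iff.1 ⟨c, hc, hev.frequently⟩

/-- **S⁺₂ (two-point side only) — top-heavy bubble along a subsequence**: the squared two-point mass of
the box of side `R` is carried by the top scale, `Σ_{w ∈ box R} G(w)² ≤ C R³ G(R e₀)²` for infinitely many
`R` (`⟸ η < 1/2`; borderline-false at `η = 1/2`, where DCP25 Thm 1.5 stops). This is the two-point half
of the random-current second-moment attempt (markdown §2b); it does NOT imply GAP by itself. -/
def TopHeavyBubbleFrequently : Prop :=
  ∃ C : ℝ, ∃ᶠ R : ℕ in atTop,
    ∑ w ∈ box 3 R, criticalTwoPoint 3 w ^ 2 ≤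
      C * (R : ℝ) ^ 3 * criticalTwoPoint 3 (Pi.single 0 (R : ℤ)) ^ 2

/-- The eventual form is exactly the conclusion of the LatticeSDP support `WindowGivesTopHeavyBubble`
(item of route LatticeSDPCertificates) fed by its crux `WindowBelowHalf` (stmt-5507). -/
theorem topHeavyBubbleFrequently_of_window
    (hW : Theses.LatticeSDPCertificates.WindowBelowHalf)
    (hT : Theses.LatticeSDPCertificates.WindowGivesTopHeavyBubble) : TopHeavyBubbleFrequently := by
  obtain ⟨C, hall⟩ := hT hW
  exact ⟨C, (Filter.eventually_atTop.2 ⟨1, hall⟩).frequently⟩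

end Summit.CriticalPhenomena.Ising3DConformalLimit.Cruxes.NearCriticalLeeYangGap.CensusS3
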